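import Summits.NavierStokesRegularity.NavierStokesRegularity.Theses.PalasekTowerBreakdown
import Summits.NavierStokesRegularity.FluidComputer.PalasekTowerRegisterGlobalHalves
import Summits.NavierStokesRegularity.FluidComputer.PalasekTowerHeredityWitnessUnconditionalRungs

/-!
# NavierStokesRegularity — route `PalasekTowerBreakdown`: its items ARE their typed witnesses, with NO uniqueness item

Supports `stmt-NavierStokesRegularity-19249` (`HeredityAtOne`, the first rung of the split crux
`EpisodeInduction`; it does NOT close it), and records the same for `HeredityFromTwo` (stmt-…-19250),
`EpisodeInduction` (stmt-…-19178) and `EpisodeBase` (stmt-…-19179). Cell `ns-blowup`, seat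
`ns-blowup-ecbridge-6` (g2; D-0074 GROUP C «BRIDGE SUPPORT»). The earlier files of this seat
(`PalasekTowerBreakdownHeredityAtOneWitness.lean` p419740, `…HeredityFromTwoWitness.lean` p419794,
`…EpisodeBaseWitness.lean` p419821) gave these links MODULO the route's support item
`TaoForcedUniqueness` (stmt-…-19180, W14 = Tao 2013 Cor. 11.4 with force). In the route's OWN
vocabulary, and now with NO hypothesis at all:

  `HeredityAtOne ↔ HeredityWitness 1`
  `HeredityFromTwo ↔ ∀ k ≥ 2, HeredityWitness k`
  `EpisodeInduction ↔ ∀ k ≥ 1, HeredityWitness k`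
  `EpisodeBase ↔ ∃ prepared host (pinned rigid quiet wide design with a registered level-0 stage)
                 carrying its own level-0 witness`,   `RungG 0 → HeredityWitness 0 → EpisodeBase`

where `Summit.NavierStokesRegularity.FluidComputer.PalasekTowerClayBridge.HeredityWitness k` is the
TYPED numerical-witness hypothesis («every pinned rigid quiet wide design that earned a registered
G-stage at level `k` has a LEVEL WITNESS: its own classical finite-energy flow from the Clay datum
under the design force reaches `τ (k+1)` below `(5/3) Y_{k+1}` on the window `[τ k, τ (k+1)]` and shows
at `τ (k+1)`, in the ball, a point of speed `≥ Y_{k+1}`, a point of strain `≥ A_{k+1}` and the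
`N_{k+1}`-core loop», FluidComputer/PalasekTowerHeredityWitness.lean p417894). Kernel content:
FluidComputer/PalasekTowerHeredityWitnessUnconditional{,Rungs}.lean (this seat) — the stage pins the
design's flow on its slab WITHOUT W14 (it is the bounded competitor by its own register ceiling
`c₂ Y_k`; both flows are Leray–Hopf with the design force by the tree theorem
`tao2011_forced_pressure_normalisation_ae_holds`; Sohr's forced Serrin–Masuda weak–strong uniqueness,
the tree theorem `serrinMasuda_weak_strong_uniqueness_forced`, identifies them), the pressure gauge is
re-fixed by Seeley extension, and the BC3 composition assembles the next stage. So MODEL data booked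
against `HeredityWitness k` discharge a NAMED hypothesis equivalent BY VALUE to the item — never the
crux under another name, and never through `TaoForcedUniqueness`. MODEL tower words stay ANALOGUES of
the witness, never instances; nothing here asserts the witness or any item.

WHAT THIS IS NOT: not NS — unconditional EQUIVALENCES between open statements; no stage, flow or
tower is constructed; nothing asserts regularity or blow-up.
-/

-- `Summit.<Summit>.<Problem>` is the tree's mandated summit-side namespace (CONVENTIONS §2); for this
-- single-conjunct summit the two coincide, so the duplicate is deliberate.
set_option linter.dupNamespace false

namespace Summit.NavierStokesRegularity.NavierStokesRegularity.Theorems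

open Summit.NavierStokesRegularity.NavierStokesRegularity.Theses
open Summit.NavierStokesRegularity.FluidComputer.PalasekTowerClayBridge

/-- **Item `HeredityAtOne` IS the typed heredity witness at level `1` — no hypothesis**:
`HeredityAtOne ↔ HeredityWitness 1` (route decl by name; the body is
`heredityAtOne_iff_heredityWitness_one`). [cite: Sohr2001, Ch. V Thm. 1.5.1] -/
theorem palasekTowerBreakdown_heredityAtOne_iff_heredityWitness_one :
    PalasekTowerBreakdown.HeredityAtOne ↔ HeredityWitness 1 := by
  unfold PalasekTowerBreakdown.HeredityAtOne
  exact heredityAtOne_iff_heredityWitness_one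

/-- `heredity_at_one ⇐ HeredityWitness 1` for the route item, unconditionally (supersedes
`palasekTowerBreakdown_heredityAtOne_of_heredityWitness (hU)`). [cite: Sohr2001, Ch. V Thm. 1.5.1] -/
theorem palasekTowerBreakdown_heredityAtOne_of_heredityWitness' (h : HeredityWitness 1) :
    PalasekTowerBreakdown.HeredityAtOne :=
  palasekTowerBreakdown_heredityAtOne_iff_heredityWitness_one.2 h

/-- **Item `HeredityFromTwo` IS the heredity witness at every level `k ≥ 2` — no hypothesis**
(supersedes `palasekTowerBreakdown_heredityFromTwo_iff_heredityWitness (hU)`).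
[cite: Sohr2001, Ch. V Thm. 1.5.1] -/
theorem palasekTowerBreakdown_heredityFromTwo_iff_heredityWitness' :
    PalasekTowerBreakdown.HeredityFromTwo ↔ ∀ k : ℕ, 2 ≤ k → HeredityWitness k := by
  unfold PalasekTowerBreakdown.HeredityFromTwo
  exact heredityFrom_iff_heredityWitness'

/-- **The parent crux `EpisodeInduction` IS the heredity witness at every level `k ≥ 1` — no
hypothesis.** [cite: Sohr2001, Ch. V Thm. 1.5.1] -/
theorem palasekTowerBreakdown_episodeInduction_iff_heredityWitness' :
    PalasekTowerBreakdown.EpisodeInduction ↔ ∀ k : ℕ, 1 ≤ k → HeredityWitness k := by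
  unfold PalasekTowerBreakdown.EpisodeInduction
  exact episodeInductionG_iff_heredityWitness'

/-- The parent crux in the shape of its split: `EpisodeInduction ↔ HeredityWitness 1 ∧
(∀ k ≥ 2, HeredityWitness k)` — no hypothesis. [cite: Sohr2001, Ch. V Thm. 1.5.1] -/
theorem palasekTowerBreakdown_episodeInduction_iff_heredityWitness_one_and_from_two :
    PalasekTowerBreakdown.EpisodeInduction ↔
      HeredityWitness 1 ∧ ∀ k : ℕ, 2 ≤ k → HeredityWitness k := by
  unfold PalasekTowerBreakdown.EpisodeInduction
  exact episodeInductionG_iff_heredityWitness_one_and_from_two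

/-- **Item `EpisodeBase` IS «some prepared host carries its own level-`0` witness» — no hypothesis**:
`EpisodeBase ↔ ∃` pinned rigid quiet wide design with a registered level-`0` G-stage (the base
skeleton's `host_preparation` shape, `RungG 0`) and a level witness at level `0` (its own classical
finite-energy flow from the Clay datum under the design force reaches `τ 1` below `(5/3) Y₁` on
`[τ 0, τ 1]` and shows at `τ 1`, in the ball, speed `≥ Y₁`, strain `≥ A₁` and the `N₁`-core loop,
`N₁ = 256^{1.1}`). Supersedes `palasekTowerBreakdown_episodeBase_of_levelWitness_zero (hU)`.
[cite: Sohr2001, Ch. V Thm. 1.5.1] -/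
theorem palasekTowerBreakdown_episodeBase_iff_exists_levelWitness_zero :
    PalasekTowerBreakdown.EpisodeBase ↔
      ∃ S : Schedule TowerRates.wide, S.Pins 8 (6 / 5) ∧ S.Rigid ∧ S.Quiet ∧
        Nonempty (Stage 1 TowerRates.wide S (Margins.routeG TowerRates.wide) 0) ∧
          S.LevelWitness 1 0 := by
  unfold PalasekTowerBreakdown.EpisodeBase
  exact episodeBaseG_iff_exists_levelWitness_zero

/-- **Item `EpisodeBase` from host preparation (`RungG 0`) and the typed heredity witness at level
`0` — no uniqueness item** (the base skeleton's composition with its universal stub `first_episode`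
in witness form; supersedes `palasekTowerBreakdown_episodeBase_of_rungG_zero_of_heredityWitness (hU)`).
[cite: Sohr2001, Ch. V Thm. 1.5.1] -/
theorem palasekTowerBreakdown_episodeBase_of_rungG_zero_of_heredityWitness' (h₀ : RungG 0)
    (h : HeredityWitness 0) : PalasekTowerBreakdown.EpisodeBase := by
  unfold PalasekTowerBreakdown.EpisodeBase
  exact episodeBaseG_of_rungG_zero_of_heredityWitness' h₀ h

/-- **The whole register pair of the route in witness form — no hypothesis**:
`EpisodeBase ∧ EpisodeInduction ↔ (∃ prepared host with its own level-0 witness) ∧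
(∀ k ≥ 1, HeredityWitness k)`. With the W14-free bridge of the tree
(`navierStokesBreakdownR3_of_step2_B`, FluidComputer/PalasekTowerClayBridgePathB.lean) the typed
witnesses are exactly what the route asks of Navier–Stokes, item by item. [cite: Sohr2001, Ch. V Thm. 1.5.1] -/
theorem palasekTowerBreakdown_episodes_iff_witnesses :
    (PalasekTowerBreakdown.EpisodeBase ∧ PalasekTowerBreakdown.EpisodeInduction) ↔
      (∃ S : Schedule TowerRates.wide, S.Pins 8 (6 / 5) ∧ S.Rigid ∧ S.Quiet ∧
        Nonempty (Stage 1 TowerRates.wide S (Margins.routeG TowerRates.wide) 0) ∧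
          S.LevelWitness 1 0) ∧
      ∀ k : ℕ, 1 ≤ k → HeredityWitness k :=
  and_congr palasekTowerBreakdown_episodeBase_iff_exists_levelWitness_zero
    palasekTowerBreakdown_episodeInduction_iff_heredityWitness'

/-- **At the generic levels the typed witnesses ARE the two BC3 stubs jointly — no hypothesis**:
`(∀ k ≥ 2, HeredityWitness k) ↔ ContinuationEnvelope ∧ ReadoutFloors` (the witness form of
`HeredityFromTwo` composed with ecbridge-5's `heredityFrom_two_iff_envelope_and_floors`, p419350;
route spelling `palasekTowerBreakdown_heredityFromTwo_iff_envelope_and_floors`, p419979). [folklore] -/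
theorem palasekTowerBreakdown_heredityWitness_from_two_iff_envelope_and_floors :
    (∀ k : ℕ, 2 ≤ k → HeredityWitness k) ↔ ContinuationEnvelope ∧ ReadoutFloors :=
  (heredityFrom_iff_heredityWitness' (k₀ := 2)).symm.trans heredityFrom_two_iff_envelope_and_floors


/-! ## Levels reached (appended by ecbridge-6 g2, v2): the items as reachability statements, no hypothesis -/

/-- **Item `HeredityAtOne` ⇔ «every pinned rigid quiet wide design that reaches level `1` reaches
level `2`»** — no hypothesis (reaching a level = a registered G-stage exists there; the register's
`∀ s ∃ s', s.Extends s'` bookkeeping is equivalent to plain nonemptiness, `heredityAtOne_iff_nonempty_two`).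
[cite: Sohr2001, Ch. V Thm. 1.5.1] -/
theorem palasekTowerBreakdown_heredityAtOne_iff_nonempty_two :
    PalasekTowerBreakdown.HeredityAtOne ↔
      ∀ S : Schedule TowerRates.wide, S.Pins 8 (6 / 5) → S.Rigid → S.Quiet →
        Nonempty (Stage 1 TowerRates.wide S (Margins.routeG TowerRates.wide) 1) →
          Nonempty (Stage 1 TowerRates.wide S (Margins.routeG TowerRates.wide) 2) := by
  unfold PalasekTowerBreakdown.HeredityAtOne
  exact heredityAtOne_iff_nonempty_two

/-- **The parent crux `EpisodeInduction` ⇔ «every pinned rigid quiet wide design that reaches level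
`1` reaches EVERY level»** — no hypothesis: K2G is a statement about the set of levels each registered
design reaches (`episodeInductionG_iff_reaches_all_levels`). [cite: Sohr2001, Ch. V Thm. 1.5.1] -/
theorem palasekTowerBreakdown_episodeInduction_iff_reaches_all_levels :
    PalasekTowerBreakdown.EpisodeInduction ↔
      ∀ S : Schedule TowerRates.wide, S.Pins 8 (6 / 5) → S.Rigid → S.Quiet →
        Nonempty (Stage 1 TowerRates.wide S (Margins.routeG TowerRates.wide) 1) →
          ∀ k : ℕ, 1 ≤ k → Nonempty (Stage 1 TowerRates.wide S (Margins.routeG TowerRates.wide) k) := by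
  unfold PalasekTowerBreakdown.EpisodeInduction
  exact episodeInductionG_iff_reaches_all_levels

end Summit.NavierStokesRegularity.NavierStokesRegularity.Theorems
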